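/-
Copyright (c) 2026 the pub-hodgecm-mathlib formalisation cell (harness21).  Prover seat hodgecm-mathlib-K2E4-p21 (g0) (outside hand on the E3 WILD CHAIN; K2E3-p17 (g0) FILE ↦ SEAT MAP 22:22:15Z:
«K2E4-p21 = NW-B»), Track B «K2-LIT» ∕ h413, unit U5Kazhdan of the line `K2_E3_EllipticInputs`: the WILD twin of ★ row-80 FILE NW-B-RAM `F0P3cStCharTSEPCrossNormZeroTame`.  2026-09-03.
-/
import Summits.HodgeConjecture.HodgeConjecture.Theorems.K2E3EPCrossNormZeroWild              -- NW-B-W FILE 1 (this seat): §1-W `innerG_char_cross_eq_zero_of_isPseudoCoeff_epThree_of_ramificationIdx_ne_one`; brings ★ NW-B-RAM, ★ 59-W(C), ★ (A)-W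
import Summits.HodgeConjecture.HodgeConjecture.Theorems.K2E3K1PseudoCoeffWitnessWild        -- ★ 58-W-W (K2E3-p17, p855272): `isPseudoCoeff_epFunction_of_ramificationIdx_ne_one_explicit` (its row-61 input `h61` stays a binder here)
import Summits.HodgeConjecture.HodgeConjecture.Theorems.K2E3EPInducedTraceZeroAtDatumDischargeWild  -- ★ 61b-W (K2E3-p16): `smoothTrace_cmPrincipalSeries_epFunction_eq_zero_of_ramificationIdx_ne_one` (ED. 2 §4-W discharges `h61`)
import HarnessLib

/-!
# K2_E3 road (h413 = stmt-HodgeConjecture-24833), unit U5Kazhdan — THE WILD ENGINE, FILE «NW-B ∕ 2» (EXPLICIT): CROSS-NORM-ZERO `⟨χ_{π′}, χ_π⟩_e = 0` on `G_v = U(Φ₃)(L⁺_v)` AT EVERY RAMIFIED PLACE,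
# WILD (dyadic) ONES INCLUDED (Rogawski 1990 §12.6 p. 187, Prop. 12.6.1 (b); Schneider–Stuhler 1997 §III.4)

Cell `pub/hodgecm-mathlib` (D-0151), Track B; seat K2E4-p21 (g0) as outside hand on the E3 wild chain (K2E3-plan (g1) DEALS BATCH #2 22:15:20Z; line lead K2E3-p17 (g0) FILE ↦ SEAT MAP
22:22:15Z «K2E4-p21 = NW-B `Theorems/K2E3EPCrossNormZeroWild.lean` (★ `F0P3cStCharTSEPCrossNormZeroTame` twin ⇒ PAYS W₂ with p16's consumer)»).  THEOREMS ONLY (no definition ∕ instance ∕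
notation ∕ named fact ∕ `sorry`); ★-only imports (never a `Cruxes/…/Lines` module); `--supports stmt-HodgeConjecture-24833 --as helper`.

WHAT.  ★ NW-B-RAM `F0P3cStCharTSEPCrossNormZeroTame` proves, at a TAMELY ramified place (the seven tame letters `hσ hvσ hϖ hσϖ hres h2 hnorm`, among them `h2 : |2|_w = 1`), that for
irreducible smooth `r, r′` of `G_v` with `Hom_G(r, r′) = 0` and every smooth extension of `r′` by `r′` split, `⟨χ_{[r′]}, χ_{[r]}⟩_e = 0` — through the Euler–Poincaré pseudo-coefficient
of `r` on the tree.  THIS FILE re-issues its three heads at EVERY RAMIFIED place `w ∣ v` (`he : e(w∣v) ≠ 1`), ANY uniformiser (`hϖ : |ϖ|_w = q⁻¹`), with NO hypothesis on `|2|_w` — so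
at the WILD (dyadic) places too — by the MAP's template rule: statements = the tame heads VERBATIM with the single binder substitution «`(hσ hvσ hϖ hσϖ hres h2 hnorm)` ↦ `(he) (hϖ)`»,
proofs = the tame proofs VERBATIM with the tame bricks replaced by their ★ wild twins: (A)-RAM `exists_vertexOrbitData_gqs_of_neg` ∕ `exists_edgeOrbitData_gqs_of_v_two` ↦ ★ (A)-W
`…_of_ramificationIdx_ne_one` (K2E3-p17), NW-A-RAM `innerG_char_eq_zero_of_forall_extension_split_of_isPseudoCoeff_epTwoFamilies_of_neg` ↦ ★ 59-W(C) `…_of_ramificationIdx_ne_one`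
(K2E1b-p03, p855251), 58-W-RAM `isPseudoCoeff_epFunction_of_neg_explicit` ↦ ★ 58-W-W `…_of_ramificationIdx_ne_one_explicit` (K2E3-p17).  Names `…_of_ramificationIdx_ne_one…`.
THIS FILE (NW-B-W FILE 2; FILE 1 = ★ `K2E3EPCrossNormZeroWild` §1-W): §2-W **`innerG_char_cross_eq_zero_of_ramificationIdx_ne_one_explicit_pieces_of_h61`** (`hpc3 := ★ 58-W-W`, the row-61
input `h61` KEPT AS A BINDER in 58-W-W's shape) · §3-W **`innerG_char_cross_eq_zero_of_ramificationIdx_ne_one_explicit_of_h61`** (the (G3)-explicit construction: level ∕ tree ∕ base edge ∕ `K`-types chosen ONCE from `r`,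
★ 73 §R's construction verbatim; the involution letters `hσ hvσ` for the apartment lemmas read off the datum) — W₂'s payer (K2E3-p16's consumer) plugs ★ 61b-W
`K2E3EPInducedTraceZeroAtDatumDischargeWild.smoothTrace_cmPrincipalSeries_epFunction_eq_zero_of_ramificationIdx_ne_one L v νQv w hw he hϖ eA` into `h61`.
EDITION LOG.  ED. 1 (★ p855403): §2-W, §3-W modulo `h61`.  ED. 2 (this text, APPEND-ONLY: one import + §4 added, §2∕§3 byte-identical): §4-W
**`innerG_char_cross_eq_zero_of_ramificationIdx_ne_one_explicit`** — `h61` discharged by ★ 61b-W (K2E3-p16), i.e. the tame head's exact wild twin with NO residual binder.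

HONEST LABEL: HC_CM is proved only modulo the 7 printed citations (2 remaining named inputs: hLiu418 = stmt-HodgeConjecture-24832, h413 = stmt-HodgeConjecture-24833) until rung 0 closes;
count-neutral helper of the E3 wild chain (socket W₂ `sig_K2E3InnerGCharCrossEqZeroWild` is paid by p16's consumer over this file); retires nothing by itself.

## References
* [Rogawski1990] J. D. Rogawski, *Automorphic Representations of Unitary Groups in Three Variables*, Ann. of Math. Stud. 123 (1990): §12.6 p. 187 (`Tr π′(f_π) = ⟨χ_{π′}, χ_π⟩_e`),
  Prop. 12.6.1 (b) p. 188.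
* [SchneiderStuhler1997] P. Schneider, U. Stuhler, *Representation theory and sheaves on the Bruhat–Tits building*, Publ. Math. IHÉS 85 (1997): §III.4 Thm. III.4.16 ff.
* [Kottwitz1988] R. E. Kottwitz, *Tamagawa numbers*, Ann. of Math. 127 (1988): §2 Theorem 2.
* [BruhatTits1972] F. Bruhat, J. Tits, *Groupes réductifs sur un corps local I*, Publ. Math. IHÉS 41 (1972): §10.
* [Jacobowitz1962] R. Jacobowitz, *Hermitian forms over local fields*, Amer. J. Math. 84 (1962): §§7–11.
-/

set_option autoImplicit false

set_option linter.dupNamespace false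

noncomputable section

open NumberField IsDedekindDomain MeasureTheory Filter Topology
open scoped Matrix MatrixGroups Pointwise Valued WithZero ComplexConjugate
open Literature.NumberTheory.Rogawski1990 Literature.NumberTheory.Rogawski1990.Ch12Sec5
open Literature.NumberTheory.Automorphic Literature.NumberTheory.Automorphic.UnitaryGroup Literature.NumberTheory.Automorphic.UnitaryLatticeTree
open Literature.NumberTheory.Automorphic.HermitianLattice
open Literature.NumberTheory.GaloisRepresentations
open Literature.Combinatorics.SimpleGraph Literature.Combinatorics.SimpleGraph.OrientedIncidence

namespace Summit.HodgeConjecture.HodgeConjecture.Cruxes.H413.K2E3EPCrossNormZeroExplicitWild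
open Summit.HodgeConjecture.HodgeConjecture.Cruxes.H413 Summit.HodgeConjecture.HodgeConjecture.Cruxes.H413.F0P3cStCharTSTorusDefs Summit.HodgeConjecture.HodgeConjecture.Cruxes.H413.F0P3cStCharTSEPNormOneUnr
open Summit.HodgeConjecture.HodgeConjecture.Cruxes.H413.F0P3cStCharTSK1UnrPseudoCoeffWitness
open Summit.HodgeConjecture.HodgeConjecture.Cruxes.H413.F0P3cStCharTSEPTraceOneAtDatum
open Summit.HodgeConjecture.HodgeConjecture.Cruxes.H413.F0P3cStCharTSTreeOrbitDataGqs
open Summit.HodgeConjecture.HodgeConjecture.Cruxes.H413.F0P3cStCharTSTreeOrbitDataGqsRamified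
open Summit.HodgeConjecture.HodgeConjecture.Cruxes.H413.F0P3cStCharTSEPCrossNormZeroUnr
open Summit.HodgeConjecture.HodgeConjecture.Cruxes.H413.F0P3cStCharTSEPCrossNormZeroTame
open Summit.HodgeConjecture.HodgeConjecture.Cruxes.H413.K2E3TreeOrbitDataGqsWild
open Summit.HodgeConjecture.HodgeConjecture.Cruxes.H413.F0P3cDyRamWildPlaceDatum
open Summit.HodgeConjecture.HodgeConjecture.Cruxes.H413.K2E3EPCrossNormZeroWild

section Head

variable (L : Type) [Field L] [NumberField L] [IsCMField L] (v : HeightOneSpectrum (𝓞 ↥(maximalRealSubfield L)))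

/-! ## §2-W `hpc3 := ★ 58-W-W`, the row-61 input kept as the binder `h61` -/

/-- **CROSS-NORM-ZERO AT EVERY RAMIFIED PLACE (tame or WILD), (G3)-EXPLICIT with the pieces given, modulo the row-61 binder `h61` — `⟨χ_{[r′]}, χ_{[r]}⟩_e = 0`** (wild twin of ★ NW-B-RAM §2: tame letters ↦ `(he) (hϖ)`, `hpc3 := ★ 58-W-W … h61 …`; original: twin of row-80 FILE B §2 with `hd` ↦ the seven tame letters IN SLOT and NOTHING more: the pseudo-coefficient is ★ 58-W-RAM `K2E3K1PseudoCoeffWitnessWild.isPseudoCoeff_epFunction_of_ramificationIdx_ne_one_explicit`, whose own `h61` input is ★ 61b-RAM `smoothTrace_cmPrincipalSeries_epFunction_eq_zero_of_neg L v νQv w hw ‹7› eA` — exactly ★ 72-NW §A-RAM's application).  §1-RAM with its ONE row-58 binder discharged; in the UNR twin: `hpc3 := ★ S2a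
isPseudoCoeff_epFunction_of_unramified_explicit … (IrrClass.mk r) rfl`.  Binders = S2a's VERBATIM (the (G3)-EXPLICIT block with `heA`, the §12.5 datum with `mQv hcanQ horb hreg hE hM1`,
the level family with `hUo hUc hEo hEc`, the APARTMENT base edge `d₁` pinned by `hd₁`, the stabilisers, `r` with `he`, the three finite-dimensionality instances, the `K`-type letters
`τᵢ hτρᵢ hτᵢ fᵢ hfPᵢ hf0ᵢ`) + ★ PCT-OUT's `hWIF hC1 hC2 hC3 hL2` + the cross letters `(r′) (hsplit₂) (hHom0)`.  NO `IsL2` ∕ `IsEllipticRep` ∕ self-`hsplit` letter.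
[cite: Rogawski1990, §12.6 p. 187] [cite: SchneiderStuhler1997, §III.4] [cite: Kottwitz1988, §2] -/
theorem innerG_char_cross_eq_zero_of_ramificationIdx_ne_one_explicit_pieces_of_h61
    (hns : ∀ w : PlacesOver L v, IsCMField.complexConj L • w.1 = w.1)
    (w : PlacesOver L v) (hw : IsCMField.complexConj L • w.1 = w.1) {ϖ : w.1.adicCompletion L}
    (he : v.asIdeal.ramificationIdx' w.1.asIdeal ≠ 1) (hϖ : Valued.v ϖ = WithZero.exp (-1 : ℤ))
    (eA : Gqs L v ≃ₜ* ↥(unitaryGroupOfForm (galAdicCompletionMap (L := L) (IsCMField.complexConj L) hw) ((StdForm.antidiagonal 3).over (w.1.adicCompletion L))))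
    (heA : ∀ g : Gqs L v, ((eA g : ↥(unitaryGroupOfForm (galAdicCompletionMap (L := L) (IsCMField.complexConj L) hw) ((StdForm.antidiagonal 3).over (w.1.adicCompletion L)))) : GL (Fin 3) (w.1.adicCompletion L)) = ((localNonsplitEquiv (IsCMField.complexConj L) (qsForm L) (IsCMField.complexConj_ne_one L) w hw g : ↥(unitaryGroupOfForm (galAdicCompletionMap (L := L) (IsCMField.complexConj L) hw) (placeForm (qsForm L) w.1))) : GL (Fin 3) (w.1.adicCompletion L)))
    [MeasurableSpace (Gqs L v)] [BorelSpace (Gqs L v)]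
    [∀ γ : Gqs L v, MeasurableSpace (Gqs L v ⧸ Subgroup.centralizer ({γ} : Set (Gqs L v)))] [∀ γ : Gqs L v, BorelSpace (Gqs L v ⧸ Subgroup.centralizer ({γ} : Set (Gqs L v)))]
    [MeasurableSpace (Gqs L v ⧸ Subgroup.center (Gqs L v))]
    {H : Type} [Group H] [TopologicalSpace H] [IsTopologicalGroup H] [MeasurableSpace H]
    (νQv : Measure (Gqs L v)) [νQv.IsHaarMeasure] [νQv.IsMulRightInvariant] (mQv : OrbitalMeasureFamily (Gqs L v))
    (hcanQ : mQv.IsCanonical (fun γ => IsRegularElt (γ.val : GL (Fin 3) (UnitaryGroup.LocalRing L v))) νQv)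
    (𝔇 : EllipticData (Gqs L v) H) (hμG : 𝔇.μG = νQv) (horb : 𝔇.orb = mQv)
    (hreg : ∀ γ : Gqs L v, γ ∈ 𝔇.regG ↔ IsRegularElt (γ.val : GL (Fin 3) (UnitaryGroup.LocalRing L v)))
    (hE : ∀ γ : Gqs L v, γ ∈ 𝔇.ellG ↔ IsRegularElt (γ.val : GL (Fin 3) (UnitaryGroup.LocalRing L v)) ∧ γ ∉ hyperbolicSet L v)
    (hM1 : ∀ π : IrrClass (Gqs L v), Measurable (𝔇.char π) ∧ LocallyIntegrable (𝔇.char π) 𝔇.μG ∧ (∀ x ∈ 𝔇.regG, ∀ᶠ y in 𝓝 x, 𝔇.char π y = 𝔇.char π x) ∧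
      ∀ φ : Gqs L v → ℂ, IsLocSmooth φ → π.smoothTrace 𝔇.μG φ = ∫ x, φ x * 𝔇.char π x ∂𝔇.μG)
    -- ◇ the row-61 input KEPT AS A BINDER in ★ 58-W-W's shape (`K2E3K1PseudoCoeffWitnessWild.isPseudoCoeff_epFunction_of_ramificationIdx_ne_one_explicit`'s `h61`);
    --   discharged by ★ 61b-W `K2E3EPInducedTraceZeroAtDatumDischargeWild.smoothTrace_cmPrincipalSeries_epFunction_eq_zero_of_ramificationIdx_ne_one L v νQv w hw he hϖ eA` (K2E3-p16) at W₂'s payer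
    (h61 : (∀ g : Gqs L v, ((eA g : ↥(unitaryGroupOfForm (galAdicCompletionMap (L := L) (IsCMField.complexConj L) hw) ((StdForm.antidiagonal 3).over (w.1.adicCompletion L)))) : GL (Fin 3) (w.1.adicCompletion L)) = ((localNonsplitEquiv (IsCMField.complexConj L) (qsForm L) (IsCMField.complexConj_ne_one L) w hw g : ↥(unitaryGroupOfForm (galAdicCompletionMap (L := L) (IsCMField.complexConj L) hw) (placeForm (qsForm L) w.1))) : GL (Fin 3) (w.1.adicCompletion L))) → ∀
      {a : (Gqs L v) →* ((latticeGraph (galAdicCompletionMap (L := L) (IsCMField.complexConj L) hw) ϖ ((StdForm.antidiagonal 3).over (w.1.adicCompletion L))) ≃g (latticeGraph (galAdicCompletionMap (L := L) (IsCMField.complexConj L) hw) ϖ ((StdForm.antidiagonal 3).over (w.1.adicCompletion L))))} (ha : ∀ g, a g = latticeGraphIso (galAdicCompletionMap (L := L) (IsCMField.complexConj L) hw) ϖ ((StdForm.antidiagonal 3).over (w.1.adicCompletion L)) (eA g))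
      (τ : Orientation (latticeGraph (galAdicCompletionMap (L := L) (IsCMField.complexConj L) hw) ϖ ((StdForm.antidiagonal 3).over (w.1.adicCompletion L)))) (hτ : ∀ d, τ.tail d < τ.head d)
      {e : ℕ} {U : {M : Submodule 𝒪[(w.1.adicCompletion L)] (Fin 3 → (w.1.adicCompletion L)) // IsVertex (galAdicCompletionMap (L := L) (IsCMField.complexConj L) hw) ϖ ((StdForm.antidiagonal 3).over (w.1.adicCompletion L)) M} → Subgroup (Gqs L v)}
      (hU : ∀ x g, g ∈ U x ↔ mapGL ((eA g : ↥(unitaryGroupOfForm (galAdicCompletionMap (L := L) (IsCMField.complexConj L) hw) ((StdForm.antidiagonal 3).over (w.1.adicCompletion L)))) : GL (Fin 3) (w.1.adicCompletion L)) x.1 = x.1 ∧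
      x.1.map ((Matrix.toLin' ((((eA g : ↥(unitaryGroupOfForm (galAdicCompletionMap (L := L) (IsCMField.complexConj L) hw) ((StdForm.antidiagonal 3).over (w.1.adicCompletion L)))) : GL (Fin 3) (w.1.adicCompletion L)) : Matrix (Fin 3) (Fin 3) (w.1.adicCompletion L)) - 1)).restrictScalars 𝒪[(w.1.adicCompletion L)]) ≤ scaleLattice (ϖ ^ (e + 1)) x.1)
      (hUo : ∀ x, IsOpen (U x : Set (Gqs L v))) (hUc : ∀ x, IsCompact (U x : Set (Gqs L v)))
      (hEo : ∀ d : (latticeGraph (galAdicCompletionMap (L := L) (IsCMField.complexConj L) hw) ϖ ((StdForm.antidiagonal 3).over (w.1.adicCompletion L))).edgeSet, IsOpen ((U (τ.head d) ⊔ U (τ.tail d) : Subgroup (Gqs L v)) : Set (Gqs L v)))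
      (hEc : ∀ d : (latticeGraph (galAdicCompletionMap (L := L) (IsCMField.complexConj L) hw) ϖ ((StdForm.antidiagonal 3).over (w.1.adicCompletion L))).edgeSet, IsCompact ((U (τ.head d) ⊔ U (τ.tail d) : Subgroup (Gqs L v)) : Set (Gqs L v)))
      {A : ℤ → {M : Submodule 𝒪[(w.1.adicCompletion L)] (Fin 3 → (w.1.adicCompletion L)) // IsVertex (galAdicCompletionMap (L := L) (IsCMField.complexConj L) hw) ϖ ((StdForm.antidiagonal 3).over (w.1.adicCompletion L)) M}} (hA0 : ∀ c : ℤ, (A (2 * c)).1 = latt (Matrix.diagonal ![ϖ ^ c, (1 : w.1.adicCompletion L), ϖ ^ (-c)])) (hA1 : ∀ c : ℤ, (A (2 * c + 1)).1 = latt (Matrix.diagonal ![ϖ ^ (c + 1), (1 : w.1.adicCompletion L), ϖ ^ (-c)]))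
      (d₁ : (latticeGraph (galAdicCompletionMap (L := L) (IsCMField.complexConj L) hw) ϖ ((StdForm.antidiagonal 3).over (w.1.adicCompletion L))).edgeSet) (hd₁ : (d₁ : Sym2 {M : Submodule 𝒪[(w.1.adicCompletion L)] (Fin 3 → (w.1.adicCompletion L)) // IsVertex (galAdicCompletionMap (L := L) (IsCMField.complexConj L) hw) ϖ ((StdForm.antidiagonal 3).over (w.1.adicCompletion L)) M}) = s(A 0, A 1)) (P₀ P₂ P₁ : Subgroup (Gqs L v))
      (hP₀ : ∀ g, g ∈ P₀ ↔ a g (τ.head d₁) = τ.head d₁) (hP₂ : ∀ g, g ∈ P₂ ↔ a g (τ.tail d₁) = τ.tail d₁) (hP₁ : ∀ g, g ∈ P₁ ↔ (a g).mapEdgeSet d₁ = d₁)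
      {V : Type} [AddCommGroup V] [Module ℂ V] (ρ : Representation ℂ (Gqs L v) V)
      (hρ : ρ.IsSmooth) (hVN : FiniteDimensional ℂ ((cmBorelTriple L 3 v).restrict ρ).Coinvariants)
      [FiniteDimensional ℂ ↥(ρ.fixedPoints (U (τ.head d₁)))] [FiniteDimensional ℂ ↥(ρ.fixedPoints (U (τ.tail d₁)))]
      [FiniteDimensional ℂ ↥(ρ.fixedPoints (U (τ.head d₁) ⊔ U (τ.tail d₁)))]
      (τ₀ : Representation ℂ ↥P₀ ↥(ρ.fixedPoints (U (τ.head d₁))))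
      (hτρ₀ : ∀ (p : ↥P₀) (x : ↥(ρ.fixedPoints (U (τ.head d₁)))), ((τ₀ p x : ↥(ρ.fixedPoints (U (τ.head d₁)))) : V) = ρ (p : (Gqs L v)) (x : V))
      (hτ₀ : ∀ p : ↥P₀, (p : (Gqs L v)) ∈ U (τ.head d₁) → τ₀ p = 1)
      (τ₂ : Representation ℂ ↥P₂ ↥(ρ.fixedPoints (U (τ.tail d₁))))
      (hτρ₂ : ∀ (p : ↥P₂) (x : ↥(ρ.fixedPoints (U (τ.tail d₁)))), ((τ₂ p x : ↥(ρ.fixedPoints (U (τ.tail d₁)))) : V) = ρ (p : (Gqs L v)) (x : V))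
      (hτ₂ : ∀ p : ↥P₂, (p : (Gqs L v)) ∈ U (τ.tail d₁) → τ₂ p = 1)
      (τ₁ : Representation ℂ ↥P₁ ↥(ρ.fixedPoints (U (τ.head d₁) ⊔ U (τ.tail d₁))))
      (hτρ₁ : ∀ (p : ↥P₁) (x : ↥(ρ.fixedPoints (U (τ.head d₁) ⊔ U (τ.tail d₁)))), ((τ₁ p x : ↥(ρ.fixedPoints (U (τ.head d₁) ⊔ U (τ.tail d₁)))) : V) = ρ (p : (Gqs L v)) (x : V))
      (hτ₁ : ∀ p : ↥P₁, (p : (Gqs L v)) ∈ U (τ.head d₁) ⊔ U (τ.tail d₁) → τ₁ p = 1)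
      {f₀ f₂ f₁ : (Gqs L v) → ℂ}
      (hfP₀ : ∀ (g : (Gqs L v)) (hg : g ∈ P₀), f₀ g = Representation.character τ₀ ⟨g, hg⟩⁻¹) (hf0₀ : ∀ g ∉ P₀, f₀ g = 0)
      (hfP₂ : ∀ (g : (Gqs L v)) (hg : g ∈ P₂), f₂ g = Representation.character τ₂ ⟨g, hg⟩⁻¹) (hf0₂ : ∀ g ∉ P₂, f₂ g = 0)
      (hfP₁ : ∀ (g : (Gqs L v)) (hg : g ∈ P₁), f₁ g = Representation.character τ₁ ⟨g, hg⟩⁻¹) (hf0₁ : ∀ g ∉ P₁, f₁ g = 0),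
      ∀ χ : ↥(cmBorelTriple L 3 v).M →* ℂˣ, (Continuous fun t => ((χ t : ℂˣ) : ℂ)) →
        Representation.smoothTrace (G := Gqs L v) (UnitaryGroup.cmPrincipalSeries L 3 v χ) νQv ((((νQv.real (P₀ : Set (Gqs L v)))⁻¹ : ℂ)) • f₀ + (((νQv.real (P₂ : Set (Gqs L v)))⁻¹ : ℂ)) • f₂ - (((νQv.real (P₁ : Set (Gqs L v)))⁻¹ : ℂ)) • f₁) = 0)
    (hWIF : 𝔇.WeylIntegrationFormula) (hC1 : 𝔇.EllCartanSubset) (hC2 : 𝔇.EllCartanAE) (hC3 : 𝔇.NonEllCartanAE) (hL2 : 𝔇.L2CharOnTorusAll)   -- ★ PCT-OUT's extra letters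
    {a : (Gqs L v) →* ((latticeGraph (galAdicCompletionMap (L := L) (IsCMField.complexConj L) hw) ϖ ((StdForm.antidiagonal 3).over (w.1.adicCompletion L))) ≃g (latticeGraph (galAdicCompletionMap (L := L) (IsCMField.complexConj L) hw) ϖ ((StdForm.antidiagonal 3).over (w.1.adicCompletion L))))} (ha : ∀ g, a g = latticeGraphIso (galAdicCompletionMap (L := L) (IsCMField.complexConj L) hw) ϖ ((StdForm.antidiagonal 3).over (w.1.adicCompletion L)) (eA g))
    (τ : Orientation (latticeGraph (galAdicCompletionMap (L := L) (IsCMField.complexConj L) hw) ϖ ((StdForm.antidiagonal 3).over (w.1.adicCompletion L)))) (hτ : ∀ d, τ.tail d < τ.head d)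
    {e : ℕ} {U : {M : Submodule 𝒪[(w.1.adicCompletion L)] (Fin 3 → (w.1.adicCompletion L)) // IsVertex (galAdicCompletionMap (L := L) (IsCMField.complexConj L) hw) ϖ ((StdForm.antidiagonal 3).over (w.1.adicCompletion L)) M} → Subgroup (Gqs L v)}
    (hU : ∀ x g, g ∈ U x ↔ mapGL ((eA g : ↥(unitaryGroupOfForm (galAdicCompletionMap (L := L) (IsCMField.complexConj L) hw) ((StdForm.antidiagonal 3).over (w.1.adicCompletion L)))) : GL (Fin 3) (w.1.adicCompletion L)) x.1 = x.1 ∧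
    x.1.map ((Matrix.toLin' ((((eA g : ↥(unitaryGroupOfForm (galAdicCompletionMap (L := L) (IsCMField.complexConj L) hw) ((StdForm.antidiagonal 3).over (w.1.adicCompletion L)))) : GL (Fin 3) (w.1.adicCompletion L)) : Matrix (Fin 3) (Fin 3) (w.1.adicCompletion L)) - 1)).restrictScalars 𝒪[(w.1.adicCompletion L)]) ≤ scaleLattice (ϖ ^ (e + 1)) x.1)
    (hUo : ∀ x, IsOpen (U x : Set (Gqs L v))) (hUc : ∀ x, IsCompact (U x : Set (Gqs L v)))
    (hEo : ∀ d : (latticeGraph (galAdicCompletionMap (L := L) (IsCMField.complexConj L) hw) ϖ ((StdForm.antidiagonal 3).over (w.1.adicCompletion L))).edgeSet, IsOpen ((U (τ.head d) ⊔ U (τ.tail d) : Subgroup (Gqs L v)) : Set (Gqs L v)))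
    (hEc : ∀ d : (latticeGraph (galAdicCompletionMap (L := L) (IsCMField.complexConj L) hw) ϖ ((StdForm.antidiagonal 3).over (w.1.adicCompletion L))).edgeSet, IsCompact ((U (τ.head d) ⊔ U (τ.tail d) : Subgroup (Gqs L v)) : Set (Gqs L v)))
    {A : ℤ → {M : Submodule 𝒪[(w.1.adicCompletion L)] (Fin 3 → (w.1.adicCompletion L)) // IsVertex (galAdicCompletionMap (L := L) (IsCMField.complexConj L) hw) ϖ ((StdForm.antidiagonal 3).over (w.1.adicCompletion L)) M}} (hA0 : ∀ c : ℤ, (A (2 * c)).1 = latt (Matrix.diagonal ![ϖ ^ c, (1 : w.1.adicCompletion L), ϖ ^ (-c)])) (hA1 : ∀ c : ℤ, (A (2 * c + 1)).1 = latt (Matrix.diagonal ![ϖ ^ (c + 1), (1 : w.1.adicCompletion L), ϖ ^ (-c)]))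
    (d₁ : (latticeGraph (galAdicCompletionMap (L := L) (IsCMField.complexConj L) hw) ϖ ((StdForm.antidiagonal 3).over (w.1.adicCompletion L))).edgeSet) (hd₁ : (d₁ : Sym2 {M : Submodule 𝒪[(w.1.adicCompletion L)] (Fin 3 → (w.1.adicCompletion L)) // IsVertex (galAdicCompletionMap (L := L) (IsCMField.complexConj L) hw) ϖ ((StdForm.antidiagonal 3).over (w.1.adicCompletion L)) M}) = s(A 0, A 1)) (P₀ P₂ P₁ : Subgroup (Gqs L v))
    (hP₀ : ∀ g, g ∈ P₀ ↔ a g (τ.head d₁) = τ.head d₁) (hP₂ : ∀ g, g ∈ P₂ ↔ a g (τ.tail d₁) = τ.tail d₁) (hP₁ : ∀ g, g ∈ P₁ ↔ (a g).mapEdgeSet d₁ = d₁)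
    (r : SmoothIrrep (Gqs L v)) (hex₀ : ∃ x₀ : {M : Submodule 𝒪[(w.1.adicCompletion L)] (Fin 3 → (w.1.adicCompletion L)) // IsVertex (galAdicCompletionMap (L := L) (IsCMField.complexConj L) hw) ϖ ((StdForm.antidiagonal 3).over (w.1.adicCompletion L)) M}, r.ρ.fixedPoints (U x₀) ≠ ⊥)
    [FiniteDimensional ℂ ↥(r.ρ.fixedPoints (U (τ.head d₁)))] [FiniteDimensional ℂ ↥(r.ρ.fixedPoints (U (τ.tail d₁)))]
    [FiniteDimensional ℂ ↥(r.ρ.fixedPoints (U (τ.head d₁) ⊔ U (τ.tail d₁)))]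
    (τ₀ : Representation ℂ ↥P₀ ↥(r.ρ.fixedPoints (U (τ.head d₁))))
    (hτρ₀ : ∀ (p : ↥P₀) (x : ↥(r.ρ.fixedPoints (U (τ.head d₁)))), ((τ₀ p x : ↥(r.ρ.fixedPoints (U (τ.head d₁)))) : r.V) = r.ρ (p : (Gqs L v)) (x : r.V))
    (hτ₀ : ∀ p : ↥P₀, (p : (Gqs L v)) ∈ U (τ.head d₁) → τ₀ p = 1)
    (τ₂ : Representation ℂ ↥P₂ ↥(r.ρ.fixedPoints (U (τ.tail d₁))))
    (hτρ₂ : ∀ (p : ↥P₂) (x : ↥(r.ρ.fixedPoints (U (τ.tail d₁)))), ((τ₂ p x : ↥(r.ρ.fixedPoints (U (τ.tail d₁)))) : r.V) = r.ρ (p : (Gqs L v)) (x : r.V))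
    (hτ₂ : ∀ p : ↥P₂, (p : (Gqs L v)) ∈ U (τ.tail d₁) → τ₂ p = 1)
    (τ₁ : Representation ℂ ↥P₁ ↥(r.ρ.fixedPoints (U (τ.head d₁) ⊔ U (τ.tail d₁))))
    (hτρ₁ : ∀ (p : ↥P₁) (x : ↥(r.ρ.fixedPoints (U (τ.head d₁) ⊔ U (τ.tail d₁)))), ((τ₁ p x : ↥(r.ρ.fixedPoints (U (τ.head d₁) ⊔ U (τ.tail d₁)))) : r.V) = r.ρ (p : (Gqs L v)) (x : r.V))
    (hτ₁ : ∀ p : ↥P₁, (p : (Gqs L v)) ∈ U (τ.head d₁) ⊔ U (τ.tail d₁) → τ₁ p = 1)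
    {f₀ f₂ f₁ : (Gqs L v) → ℂ}
    (hfP₀ : ∀ (g : (Gqs L v)) (hg : g ∈ P₀), f₀ g = Representation.character τ₀ ⟨g, hg⟩⁻¹) (hf0₀ : ∀ g ∉ P₀, f₀ g = 0)
    (hfP₂ : ∀ (g : (Gqs L v)) (hg : g ∈ P₂), f₂ g = Representation.character τ₂ ⟨g, hg⟩⁻¹) (hf0₂ : ∀ g ∉ P₂, f₂ g = 0)
    (hfP₁ : ∀ (g : (Gqs L v)) (hg : g ∈ P₁), f₁ g = Representation.character τ₁ ⟨g, hg⟩⁻¹) (hf0₁ : ∀ g ∉ P₁, f₁ g = 0)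
    -- the CROSS letters: a second irreducible smooth `r′`; every SMOOTH extension of `r.ρ` BY `r′.ρ` splits (★ (J′)'s text at `V := r.ρ`, `W := r′.ρ`); `Hom_G(r, r′) = 0`
    (r' : SmoothIrrep (Gqs L v))
    (hsplit₂ : ∀ (E : Type) [AddCommGroup E] [Module ℂ E] (ρE : Representation ℂ (Gqs L v) E), ρE.IsSmooth →
      ∀ (i : r'.ρ.IntertwiningMap ρE) (p : ρE.IntertwiningMap r.ρ), Function.Injective i → LinearMap.ker p.toLinearMap = LinearMap.range i.toLinearMap →
        Function.Surjective p → ∃ s : r.ρ.IntertwiningMap ρE, p.comp s = Representation.IntertwiningMap.id r.ρ)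
    (hHom0 : Subsingleton (r.ρ.IntertwiningMap r'.ρ)) :
    𝔇.innerG (𝔇.char (IrrClass.mk r')) (𝔇.char (IrrClass.mk r)) = 0 :=
  innerG_char_cross_eq_zero_of_isPseudoCoeff_epThree_of_ramificationIdx_ne_one L v hns w hw he hϖ eA ha νQv 𝔇 hμG hreg hM1 hWIF hC1 hC2 hC3 hL2 τ hτ hU d₁ P₀ P₂ P₁ hP₀ hP₂ hP₁ r hex₀
    τ₀ hτρ₀ τ₂ hτρ₂ τ₁ hτρ₁ hfP₀ hf0₀ hfP₂ hf0₂ hfP₁ hf0₁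
    (K2E3K1PseudoCoeffWitnessWild.isPseudoCoeff_epFunction_of_ramificationIdx_ne_one_explicit L v hns w hw he hϖ eA heA νQv mQv hcanQ 𝔇 hμG horb hreg hE hM1 h61 ha τ hτ hU hUo hUc hEo hEc
      hA0 hA1 d₁ hd₁ P₀ P₂ P₁ hP₀ hP₂ hP₁ r hex₀ τ₀ hτρ₀ hτ₀ τ₂ hτρ₂ hτ₂ τ₁ hτρ₁ hτ₁ hfP₀ hf0₀ hfP₂ hf0₂ hfP₁ hf0₁ (IrrClass.mk r) rfl) r' hsplit₂ hHom0


/-! ## §3-W (G3)-EXPLICIT letters at EVERY ramified place, modulo `h61` -/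

set_option maxHeartbeats 1600000 in
-- instance-term unification on the CM local carriers and the vertex subtype (as ★ 73 §R ∕ ★ 72-NW §B-RAM ∕ ★ 41g-H)
/-- **§3-W CROSS-NORM-ZERO AT EVERY RAMIFIED PLACE (tame or WILD), (G3)-EXPLICIT letters, modulo the row-61 binder `h61`** (wild twin of ★ NW-B-RAM §3: the seven tame letters ↦ `(he) (hϖ)`, `hσ hvσ` read off ★ `exists_isRamifiedQuadraticDatum_of_placesOver`, tame bricks ↦ ★ wild twins) (twin of row-80 FILE B §3 on ★ 73 §R's pattern: `hd` ↦ the seven tame letters IN SLOT; the apartment ∕ base edge by ★ 56-B1 `exists_apartmentEnum_of_involution` ∕ `latticeGraph_adj_apartmentEnum_succ_of_involution`, the level topology by ★ H-RAM `_of_involution`; conclusion and every other binder VERBATIM).  At a non-split place `v` with `σ_w ϖ = −ϖ`, `|2|_w = 1` and the one-place model `(w hw ϖ eA heA)`, at a §12.5 datum `𝔇` with the junction pins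
`hμG horb hreg hE hM1` and ★ PCT-OUT's `hWIF hC1 hC2 hC3 hL2`: **for irreducible smooth `r`, `r′` of `U(Φ₃)(L⁺_v)` such that every SMOOTH extension of `r` by `r′` splits (`hsplit₂`) and
`Hom_G(r, r′) = 0` (`hHom0`), `⟨χ_⟦r′⟧, χ_⟦r⟧⟩_e = 0`.**  Proof = ★ 73 §U's construction VERBATIM (level `e` by ★ 43 below the open stabiliser of a non-zero vector of `r` at the apartment
vertex `A 0` ★ 39γ, tree letters ★ 41g-H §2, invariant orientation, base edge `A 0 — A 1`, stabilisers through `eA`, `K`-types ★ 58 FILE 1 §0, pieces by `dite`) then §2.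
NO class letter (`IsL2` ∕ `IsEllipticRep` ∕ l.d.s. membership ∕ unitarity). [cite: Rogawski1990, §12.6 p. 187; Prop. 12.6.1 (b) p. 188] [cite: SchneiderStuhler1997, Thm. III.4.16, §III.4]
[cite: Kottwitz1988, §2] [cite: BruhatTits1972, §10] -/
theorem innerG_char_cross_eq_zero_of_ramificationIdx_ne_one_explicit_of_h61
    (hns : ∀ w : PlacesOver L v, IsCMField.complexConj L • w.1 = w.1)
    (w : PlacesOver L v) (hw : IsCMField.complexConj L • w.1 = w.1) {ϖ : w.1.adicCompletion L}
    (he : v.asIdeal.ramificationIdx' w.1.asIdeal ≠ 1) (hϖ : Valued.v ϖ = WithZero.exp (-1 : ℤ))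
    (eA : Gqs L v ≃ₜ* ↥(unitaryGroupOfForm (galAdicCompletionMap (L := L) (IsCMField.complexConj L) hw) ((StdForm.antidiagonal 3).over (w.1.adicCompletion L))))
    (heA : ∀ g : Gqs L v, ((eA g : ↥(unitaryGroupOfForm (galAdicCompletionMap (L := L) (IsCMField.complexConj L) hw) ((StdForm.antidiagonal 3).over (w.1.adicCompletion L)))) : GL (Fin 3) (w.1.adicCompletion L)) = ((localNonsplitEquiv (IsCMField.complexConj L) (qsForm L) (IsCMField.complexConj_ne_one L) w hw g : ↥(unitaryGroupOfForm (galAdicCompletionMap (L := L) (IsCMField.complexConj L) hw) (placeForm (qsForm L) w.1))) : GL (Fin 3) (w.1.adicCompletion L)))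
    [MeasurableSpace (Gqs L v)] [BorelSpace (Gqs L v)]
    [∀ γ : Gqs L v, MeasurableSpace (Gqs L v ⧸ Subgroup.centralizer ({γ} : Set (Gqs L v)))] [∀ γ : Gqs L v, BorelSpace (Gqs L v ⧸ Subgroup.centralizer ({γ} : Set (Gqs L v)))]
    [MeasurableSpace (Gqs L v ⧸ Subgroup.center (Gqs L v))]
    {H : Type} [Group H] [TopologicalSpace H] [IsTopologicalGroup H] [MeasurableSpace H]
    (νQv : Measure (Gqs L v)) [νQv.IsHaarMeasure] [νQv.IsMulRightInvariant] (mQv : OrbitalMeasureFamily (Gqs L v))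
    (hcanQ : mQv.IsCanonical (fun γ => IsRegularElt (γ.val : GL (Fin 3) (UnitaryGroup.LocalRing L v))) νQv)
    (𝔇 : EllipticData (Gqs L v) H) (hμG : 𝔇.μG = νQv) (horb : 𝔇.orb = mQv)
    (hreg : ∀ γ : Gqs L v, γ ∈ 𝔇.regG ↔ IsRegularElt (γ.val : GL (Fin 3) (UnitaryGroup.LocalRing L v)))
    (hE : ∀ γ : Gqs L v, γ ∈ 𝔇.ellG ↔ IsRegularElt (γ.val : GL (Fin 3) (UnitaryGroup.LocalRing L v)) ∧ γ ∉ hyperbolicSet L v)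
    (hM1 : ∀ π : IrrClass (Gqs L v), Measurable (𝔇.char π) ∧ LocallyIntegrable (𝔇.char π) 𝔇.μG ∧ (∀ x ∈ 𝔇.regG, ∀ᶠ y in 𝓝 x, 𝔇.char π y = 𝔇.char π x) ∧
      ∀ φ : Gqs L v → ℂ, IsLocSmooth φ → π.smoothTrace 𝔇.μG φ = ∫ x, φ x * 𝔇.char π x ∂𝔇.μG)
    -- ◇ the row-61 input KEPT AS A BINDER in ★ 58-W-W's shape (`K2E3K1PseudoCoeffWitnessWild.isPseudoCoeff_epFunction_of_ramificationIdx_ne_one_explicit`'s `h61`);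
    --   discharged by ★ 61b-W `K2E3EPInducedTraceZeroAtDatumDischargeWild.smoothTrace_cmPrincipalSeries_epFunction_eq_zero_of_ramificationIdx_ne_one L v νQv w hw he hϖ eA` (K2E3-p16) at W₂'s payer
    (h61 : (∀ g : Gqs L v, ((eA g : ↥(unitaryGroupOfForm (galAdicCompletionMap (L := L) (IsCMField.complexConj L) hw) ((StdForm.antidiagonal 3).over (w.1.adicCompletion L)))) : GL (Fin 3) (w.1.adicCompletion L)) = ((localNonsplitEquiv (IsCMField.complexConj L) (qsForm L) (IsCMField.complexConj_ne_one L) w hw g : ↥(unitaryGroupOfForm (galAdicCompletionMap (L := L) (IsCMField.complexConj L) hw) (placeForm (qsForm L) w.1))) : GL (Fin 3) (w.1.adicCompletion L))) → ∀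
      {a : (Gqs L v) →* ((latticeGraph (galAdicCompletionMap (L := L) (IsCMField.complexConj L) hw) ϖ ((StdForm.antidiagonal 3).over (w.1.adicCompletion L))) ≃g (latticeGraph (galAdicCompletionMap (L := L) (IsCMField.complexConj L) hw) ϖ ((StdForm.antidiagonal 3).over (w.1.adicCompletion L))))} (ha : ∀ g, a g = latticeGraphIso (galAdicCompletionMap (L := L) (IsCMField.complexConj L) hw) ϖ ((StdForm.antidiagonal 3).over (w.1.adicCompletion L)) (eA g))
      (τ : Orientation (latticeGraph (galAdicCompletionMap (L := L) (IsCMField.complexConj L) hw) ϖ ((StdForm.antidiagonal 3).over (w.1.adicCompletion L)))) (hτ : ∀ d, τ.tail d < τ.head d)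
      {e : ℕ} {U : {M : Submodule 𝒪[(w.1.adicCompletion L)] (Fin 3 → (w.1.adicCompletion L)) // IsVertex (galAdicCompletionMap (L := L) (IsCMField.complexConj L) hw) ϖ ((StdForm.antidiagonal 3).over (w.1.adicCompletion L)) M} → Subgroup (Gqs L v)}
      (hU : ∀ x g, g ∈ U x ↔ mapGL ((eA g : ↥(unitaryGroupOfForm (galAdicCompletionMap (L := L) (IsCMField.complexConj L) hw) ((StdForm.antidiagonal 3).over (w.1.adicCompletion L)))) : GL (Fin 3) (w.1.adicCompletion L)) x.1 = x.1 ∧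
      x.1.map ((Matrix.toLin' ((((eA g : ↥(unitaryGroupOfForm (galAdicCompletionMap (L := L) (IsCMField.complexConj L) hw) ((StdForm.antidiagonal 3).over (w.1.adicCompletion L)))) : GL (Fin 3) (w.1.adicCompletion L)) : Matrix (Fin 3) (Fin 3) (w.1.adicCompletion L)) - 1)).restrictScalars 𝒪[(w.1.adicCompletion L)]) ≤ scaleLattice (ϖ ^ (e + 1)) x.1)
      (hUo : ∀ x, IsOpen (U x : Set (Gqs L v))) (hUc : ∀ x, IsCompact (U x : Set (Gqs L v)))
      (hEo : ∀ d : (latticeGraph (galAdicCompletionMap (L := L) (IsCMField.complexConj L) hw) ϖ ((StdForm.antidiagonal 3).over (w.1.adicCompletion L))).edgeSet, IsOpen ((U (τ.head d) ⊔ U (τ.tail d) : Subgroup (Gqs L v)) : Set (Gqs L v)))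
      (hEc : ∀ d : (latticeGraph (galAdicCompletionMap (L := L) (IsCMField.complexConj L) hw) ϖ ((StdForm.antidiagonal 3).over (w.1.adicCompletion L))).edgeSet, IsCompact ((U (τ.head d) ⊔ U (τ.tail d) : Subgroup (Gqs L v)) : Set (Gqs L v)))
      {A : ℤ → {M : Submodule 𝒪[(w.1.adicCompletion L)] (Fin 3 → (w.1.adicCompletion L)) // IsVertex (galAdicCompletionMap (L := L) (IsCMField.complexConj L) hw) ϖ ((StdForm.antidiagonal 3).over (w.1.adicCompletion L)) M}} (hA0 : ∀ c : ℤ, (A (2 * c)).1 = latt (Matrix.diagonal ![ϖ ^ c, (1 : w.1.adicCompletion L), ϖ ^ (-c)])) (hA1 : ∀ c : ℤ, (A (2 * c + 1)).1 = latt (Matrix.diagonal ![ϖ ^ (c + 1), (1 : w.1.adicCompletion L), ϖ ^ (-c)]))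
      (d₁ : (latticeGraph (galAdicCompletionMap (L := L) (IsCMField.complexConj L) hw) ϖ ((StdForm.antidiagonal 3).over (w.1.adicCompletion L))).edgeSet) (hd₁ : (d₁ : Sym2 {M : Submodule 𝒪[(w.1.adicCompletion L)] (Fin 3 → (w.1.adicCompletion L)) // IsVertex (galAdicCompletionMap (L := L) (IsCMField.complexConj L) hw) ϖ ((StdForm.antidiagonal 3).over (w.1.adicCompletion L)) M}) = s(A 0, A 1)) (P₀ P₂ P₁ : Subgroup (Gqs L v))
      (hP₀ : ∀ g, g ∈ P₀ ↔ a g (τ.head d₁) = τ.head d₁) (hP₂ : ∀ g, g ∈ P₂ ↔ a g (τ.tail d₁) = τ.tail d₁) (hP₁ : ∀ g, g ∈ P₁ ↔ (a g).mapEdgeSet d₁ = d₁)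
      {V : Type} [AddCommGroup V] [Module ℂ V] (ρ : Representation ℂ (Gqs L v) V)
      (hρ : ρ.IsSmooth) (hVN : FiniteDimensional ℂ ((cmBorelTriple L 3 v).restrict ρ).Coinvariants)
      [FiniteDimensional ℂ ↥(ρ.fixedPoints (U (τ.head d₁)))] [FiniteDimensional ℂ ↥(ρ.fixedPoints (U (τ.tail d₁)))]
      [FiniteDimensional ℂ ↥(ρ.fixedPoints (U (τ.head d₁) ⊔ U (τ.tail d₁)))]
      (τ₀ : Representation ℂ ↥P₀ ↥(ρ.fixedPoints (U (τ.head d₁))))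
      (hτρ₀ : ∀ (p : ↥P₀) (x : ↥(ρ.fixedPoints (U (τ.head d₁)))), ((τ₀ p x : ↥(ρ.fixedPoints (U (τ.head d₁)))) : V) = ρ (p : (Gqs L v)) (x : V))
      (hτ₀ : ∀ p : ↥P₀, (p : (Gqs L v)) ∈ U (τ.head d₁) → τ₀ p = 1)
      (τ₂ : Representation ℂ ↥P₂ ↥(ρ.fixedPoints (U (τ.tail d₁))))
      (hτρ₂ : ∀ (p : ↥P₂) (x : ↥(ρ.fixedPoints (U (τ.tail d₁)))), ((τ₂ p x : ↥(ρ.fixedPoints (U (τ.tail d₁)))) : V) = ρ (p : (Gqs L v)) (x : V))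
      (hτ₂ : ∀ p : ↥P₂, (p : (Gqs L v)) ∈ U (τ.tail d₁) → τ₂ p = 1)
      (τ₁ : Representation ℂ ↥P₁ ↥(ρ.fixedPoints (U (τ.head d₁) ⊔ U (τ.tail d₁))))
      (hτρ₁ : ∀ (p : ↥P₁) (x : ↥(ρ.fixedPoints (U (τ.head d₁) ⊔ U (τ.tail d₁)))), ((τ₁ p x : ↥(ρ.fixedPoints (U (τ.head d₁) ⊔ U (τ.tail d₁)))) : V) = ρ (p : (Gqs L v)) (x : V))
      (hτ₁ : ∀ p : ↥P₁, (p : (Gqs L v)) ∈ U (τ.head d₁) ⊔ U (τ.tail d₁) → τ₁ p = 1)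
      {f₀ f₂ f₁ : (Gqs L v) → ℂ}
      (hfP₀ : ∀ (g : (Gqs L v)) (hg : g ∈ P₀), f₀ g = Representation.character τ₀ ⟨g, hg⟩⁻¹) (hf0₀ : ∀ g ∉ P₀, f₀ g = 0)
      (hfP₂ : ∀ (g : (Gqs L v)) (hg : g ∈ P₂), f₂ g = Representation.character τ₂ ⟨g, hg⟩⁻¹) (hf0₂ : ∀ g ∉ P₂, f₂ g = 0)
      (hfP₁ : ∀ (g : (Gqs L v)) (hg : g ∈ P₁), f₁ g = Representation.character τ₁ ⟨g, hg⟩⁻¹) (hf0₁ : ∀ g ∉ P₁, f₁ g = 0),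
      ∀ χ : ↥(cmBorelTriple L 3 v).M →* ℂˣ, (Continuous fun t => ((χ t : ℂˣ) : ℂ)) →
        Representation.smoothTrace (G := Gqs L v) (UnitaryGroup.cmPrincipalSeries L 3 v χ) νQv ((((νQv.real (P₀ : Set (Gqs L v)))⁻¹ : ℂ)) • f₀ + (((νQv.real (P₂ : Set (Gqs L v)))⁻¹ : ℂ)) • f₂ - (((νQv.real (P₁ : Set (Gqs L v)))⁻¹ : ℂ)) • f₁) = 0)
    (hWIF : 𝔇.WeylIntegrationFormula) (hC1 : 𝔇.EllCartanSubset) (hC2 : 𝔇.EllCartanAE) (hC3 : 𝔇.NonEllCartanAE) (hL2 : 𝔇.L2CharOnTorusAll)   -- ★ PCT-OUT's extra letters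
    (r : SmoothIrrep (Gqs L v))
    -- the CROSS letters: a second irreducible smooth `r′`; every SMOOTH extension of `r.ρ` BY `r′.ρ` splits (★ (J′)'s text at `V := r.ρ`, `W := r′.ρ`); `Hom_G(r, r′) = 0`
    (r' : SmoothIrrep (Gqs L v))
    (hsplit₂ : ∀ (E : Type) [AddCommGroup E] [Module ℂ E] (ρE : Representation ℂ (Gqs L v) E), ρE.IsSmooth →
      ∀ (i : r'.ρ.IntertwiningMap ρE) (p : ρE.IntertwiningMap r.ρ), Function.Injective i → LinearMap.ker p.toLinearMap = LinearMap.range i.toLinearMap →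
        Function.Surjective p → ∃ s : r.ρ.IntertwiningMap ρE, p.comp s = Representation.IntertwiningMap.id r.ρ)
    (hHom0 : Subsingleton (r.ρ.IntertwiningMap r'.ρ)) :
    𝔇.innerG (𝔇.char (IrrClass.mk r')) (𝔇.char (IrrClass.mk r)) = 0 := by
  -- the ramified quadratic datum at `w` (any uniformiser, no parity ∕ tameness condition): the involution letters `hσ hvσ` for the apartment ∕ adjacency lemmas
  letI : Fintype 𝓀[w.1.adicCompletion L] := Fintype.ofFinite _
  obtain ⟨nd, nt, hD⟩ := exists_isRamifiedQuadraticDatum_of_placesOver L w hw he ϖ hϖ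
  obtain ⟨hσ, hvσ, -, -, -, -, -⟩ := hD
  classical
  haveI : r.ρ.IsIrreducible := r.isIrreducible
  haveI : NonarchimedeanGroup (Gqs L v) :=
    nonarchimedeanGroup_unitaryGroupOfForm_local (E := L) (c := IsCMField.complexConj L) (N := 3) (v := v) (J' := (adelicForm L 3 (qsForm L)).map (adeleToLocal L v))
  haveI := compactSpace_integer_adicCompletion L w.1
  have hadm : r.ρ.IsAdmissible := F0P3cStCharTSScTracePackage.isAdmissible_smoothIrrep L v hns r
  have hϖ0 : ϖ ≠ 0 := CartanUnique.uniformizer_ne_zero hϖ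
  have hϖ1 : Valued.v ϖ < 1 := by rw [hϖ, ← WithZero.exp_zero]; exact WithZero.exp_lt_exp.2 (by norm_num)
  -- (E) a non-zero vector, its open stabiliser, the base vertex `A 0` with a frame `g₀`, and the level `e` (★ 43)
  haveI : Nontrivial r.V := Representation.IsIrreducible.nontrivial r.ρ
  obtain ⟨v₁, hv₁⟩ := exists_ne (0 : r.V)
  have hSo : IsOpen ((r.ρ.stabilizerSubgroup v₁ : Subgroup (Gqs L v)) : Set (Gqs L v)) := r.isSmooth v₁
  obtain ⟨A, hA0, hA1⟩ := exists_apartmentEnum_of_involution hσ hvσ hϖ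
  obtain ⟨g₀, hg₀⟩ := exists_coe_eq_latt (galAdicCompletionMap (L := L) (IsCMField.complexConj L) hw) ϖ ((StdForm.antidiagonal 3).over (w.1.adicCompletion L)) (A 0)
  have hWo : IsOpen ((eA.symm : ↥(unitaryGroupOfForm (galAdicCompletionMap (L := L) (IsCMField.complexConj L) hw) ((StdForm.antidiagonal 3).over (w.1.adicCompletion L))) → Gqs L v) ⁻¹' ((r.ρ.stabilizerSubgroup v₁ : Subgroup (Gqs L v)) : Set (Gqs L v))) :=
    hSo.preimage eA.symm.continuous
  have hW1 : (1 : ↥(unitaryGroupOfForm (galAdicCompletionMap (L := L) (IsCMField.complexConj L) hw) ((StdForm.antidiagonal 3).over (w.1.adicCompletion L)))) ∈ (eA.symm : ↥(unitaryGroupOfForm (galAdicCompletionMap (L := L) (IsCMField.complexConj L) hw) ((StdForm.antidiagonal 3).over (w.1.adicCompletion L))) → Gqs L v) ⁻¹' ((r.ρ.stabilizerSubgroup v₁ : Subgroup (Gqs L v)) : Set (Gqs L v)) := by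
    show eA.symm 1 ∈ ((r.ρ.stabilizerSubgroup v₁ : Subgroup (Gqs L v)) : Set (Gqs L v))
    rw [map_one]
    exact (r.ρ.stabilizerSubgroup v₁).one_mem
  obtain ⟨e', he', h43⟩ := exists_forall_map_sub_one_latt_le_scaleLattice_pow_imp_mem_unitary (galAdicCompletionMap (L := L) (IsCMField.complexConj L) hw) ((StdForm.antidiagonal 3).over (w.1.adicCompletion L)) hϖ0 hϖ1 g₀ hWo hW1 1
  obtain ⟨e, rfl⟩ : ∃ e : ℕ, e' = e + 1 := ⟨e' - 1, by omega⟩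
  -- (T) the tree letters at level `e` (★ 41g-H §2)
  obtain ⟨a, U, ha, hU⟩ := F0P3cStCharTSCharacterEllipticUniform.exists_actionHom_unitaryLevelFamily L v w hw eA e
  have hUo : ∀ x, IsOpen (U x : Set (Gqs L v)) := fun x => F0P3cStCharTSCharacterEllipticUniformRamified.isOpen_coe_unitaryLevel_gqs_of_involution (eA := eA) hU hϖ x
  have hUc : ∀ x, IsCompact (U x : Set (Gqs L v)) := fun x => F0P3cStCharTSCharacterEllipticUniformRamified.isCompact_coe_unitaryLevel_gqs_of_involution (eA := eA) hU hϖ x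
  have hex₀ : ∃ x₀ : {M : Submodule 𝒪[(w.1.adicCompletion L)] (Fin 3 → (w.1.adicCompletion L)) // IsVertex (galAdicCompletionMap (L := L) (IsCMField.complexConj L) hw) ϖ ((StdForm.antidiagonal 3).over (w.1.adicCompletion L)) M}, r.ρ.fixedPoints (U x₀) ≠ ⊥ := by
    refine ⟨A 0, (Submodule.ne_bot_iff _).2 ⟨v₁, ?_, hv₁⟩⟩
    rw [Representation.mem_fixedPoints]
    intro g hg
    obtain ⟨-, hle⟩ := (hU (A 0) g).1 hg
    rw [hg₀] at hle
    have hmem : eA.symm (eA g) ∈ ((r.ρ.stabilizerSubgroup v₁ : Subgroup (Gqs L v)) : Set (Gqs L v)) := h43 (eA g) hle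
    rw [eA.symm_apply_apply] at hmem
    exact hmem
  -- (O) orientation, edge groups, base edge, stabilisers
  obtain ⟨τ, hτ⟩ := exists_orientation_latticeGraph (galAdicCompletionMap (L := L) (IsCMField.complexConj L) hw) ϖ ((StdForm.antidiagonal 3).over (w.1.adicCompletion L))
  have hfixE : ∀ (g : Gqs L v) (d : (latticeGraph (galAdicCompletionMap (L := L) (IsCMField.complexConj L) hw) ϖ ((StdForm.antidiagonal 3).over (w.1.adicCompletion L))).edgeSet), (a g).mapEdgeSet d = d ↔ a g (τ.head d) = τ.head d ∧ a g (τ.tail d) = τ.tail d := fun g d => by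
    have h := head_mapEdgeSet_latticeGraphIso (galAdicCompletionMap (L := L) (IsCMField.complexConj L) hw) ϖ ((StdForm.antidiagonal 3).over (w.1.adicCompletion L)) hτ (eA g) d
    rw [← ha] at h
    exact iso_mapEdgeSet_eq_iff τ (a g) d h.1 h.2
  have hEo : ∀ d : (latticeGraph (galAdicCompletionMap (L := L) (IsCMField.complexConj L) hw) ϖ ((StdForm.antidiagonal 3).over (w.1.adicCompletion L))).edgeSet, IsOpen ((U (τ.head d) ⊔ U (τ.tail d) : Subgroup (Gqs L v)) : Set (Gqs L v)) := fun d =>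
    F0P3cStCharTSCharacterEllipticUniformRamified.isOpen_coe_sup_unitaryLevel_gqs_of_involution (eA := eA) hU hϖ _ _
  have hEc : ∀ d : (latticeGraph (galAdicCompletionMap (L := L) (IsCMField.complexConj L) hw) ϖ ((StdForm.antidiagonal 3).over (w.1.adicCompletion L))).edgeSet, IsCompact ((U (τ.head d) ⊔ U (τ.tail d) : Subgroup (Gqs L v)) : Set (Gqs L v)) := fun d =>
    F0P3cStCharTSCharacterEllipticUniformRamified.isCompact_coe_sup_unitaryLevel_gqs_of_adj_of_involution (eA := eA) hU hvσ hϖ (τ.adj_head_tail d)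
  have hadj : (latticeGraph (galAdicCompletionMap (L := L) (IsCMField.complexConj L) hw) ϖ ((StdForm.antidiagonal 3).over (w.1.adicCompletion L))).Adj (A 0) (A 1) := by
    simpa using latticeGraph_adj_apartmentEnum_succ_of_involution hσ hvσ hϖ A hA0 hA1 0
  obtain ⟨d₁, hd₁⟩ : ∃ d₁ : (latticeGraph (galAdicCompletionMap (L := L) (IsCMField.complexConj L) hw) ϖ ((StdForm.antidiagonal 3).over (w.1.adicCompletion L))).edgeSet, (d₁ : Sym2 {M : Submodule 𝒪[(w.1.adicCompletion L)] (Fin 3 → (w.1.adicCompletion L)) // IsVertex (galAdicCompletionMap (L := L) (IsCMField.complexConj L) hw) ϖ ((StdForm.antidiagonal 3).over (w.1.adicCompletion L)) M}) = s(A 0, A 1) := ⟨⟨s(A 0, A 1), (SimpleGraph.mem_edgeSet _).2 hadj⟩, rfl⟩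
  have hstab : ∀ x : {M : Submodule 𝒪[(w.1.adicCompletion L)] (Fin 3 → (w.1.adicCompletion L)) // IsVertex (galAdicCompletionMap (L := L) (IsCMField.complexConj L) hw) ϖ ((StdForm.antidiagonal 3).over (w.1.adicCompletion L)) M}, ∃ P : Subgroup (Gqs L v), ∀ g, g ∈ P ↔ a g x = x := fun x => by
    obtain ⟨Q, hQ⟩ := exists_stabilizerSubgroup (galAdicCompletionMap (L := L) (IsCMField.complexConj L) hw) ϖ ((StdForm.antidiagonal 3).over (w.1.adicCompletion L)) x
    exact ⟨Q.comap eA.toMonoidHom, fun g => by rw [F0P3cStCharTSCharacterEllipticUniform.mem_comap_iff', hQ, ha]⟩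
  obtain ⟨P₀, hP₀⟩ := hstab (τ.head d₁)
  obtain ⟨P₂, hP₂⟩ := hstab (τ.tail d₁)
  obtain ⟨P₁, hP₁⟩ : ∃ P₁ : Subgroup (Gqs L v), ∀ g, g ∈ P₁ ↔ (a g).mapEdgeSet d₁ = d₁ :=
    ⟨P₀ ⊓ P₂, fun g => by rw [Subgroup.mem_inf, hP₀, hP₂, hfixE]⟩
  -- stabilisers inside normalisers (★ (U3)), for the `K`-types
  have hPU₀ : P₀ ≤ Subgroup.normalizer ((U (τ.head d₁) : Subgroup (Gqs L v)) : Set (Gqs L v)) := fun g hg =>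
    F0P3cStCharTSCharacterEllipticUniform.mem_normalizer_unitaryLevel_gqs_of_apply_eq ha hU ((hP₀ g).1 hg)
  have hPU₂ : P₂ ≤ Subgroup.normalizer ((U (τ.tail d₁) : Subgroup (Gqs L v)) : Set (Gqs L v)) := fun g hg =>
    F0P3cStCharTSCharacterEllipticUniform.mem_normalizer_unitaryLevel_gqs_of_apply_eq ha hU ((hP₂ g).1 hg)
  have hPU₁ : P₁ ≤ Subgroup.normalizer ((U (τ.head d₁) ⊔ U (τ.tail d₁) : Subgroup (Gqs L v)) : Set (Gqs L v)) := fun g hg =>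
    Subgroup.normalizer_inf_normalizer_le_normalizer_sup (U (τ.head d₁)) (U (τ.tail d₁))
      (Subgroup.mem_inf.2 ⟨F0P3cStCharTSCharacterEllipticUniform.mem_normalizer_unitaryLevel_gqs_of_apply_eq ha hU ((hfixE g d₁).1 ((hP₁ g).1 hg)).1,
        F0P3cStCharTSCharacterEllipticUniform.mem_normalizer_unitaryLevel_gqs_of_apply_eq ha hU ((hfixE g d₁).1 ((hP₁ g).1 hg)).2⟩)
  -- finite-dimensional fixed spaces (admissibility), the three `K`-type restrictions (§0), the three pieces
  haveI : FiniteDimensional ℂ ↥(r.ρ.fixedPoints (U (τ.head d₁))) := hadm.finite_fixedPoints ⟨U (τ.head d₁), hUo _⟩ (hUc _)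
  haveI : FiniteDimensional ℂ ↥(r.ρ.fixedPoints (U (τ.tail d₁))) := hadm.finite_fixedPoints ⟨U (τ.tail d₁), hUo _⟩ (hUc _)
  haveI : FiniteDimensional ℂ ↥(r.ρ.fixedPoints (U (τ.head d₁) ⊔ U (τ.tail d₁))) := hadm.finite_fixedPoints ⟨U (τ.head d₁) ⊔ U (τ.tail d₁), hEo d₁⟩ (hEc d₁)
  obtain ⟨τ₀, hτρ₀, hτ₀⟩ := exists_restrictRep_fixedPoints r.ρ P₀ (U (τ.head d₁)) hPU₀
  obtain ⟨τ₂, hτρ₂, hτ₂⟩ := exists_restrictRep_fixedPoints r.ρ P₂ (U (τ.tail d₁)) hPU₂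
  obtain ⟨τ₁, hτρ₁, hτ₁⟩ := exists_restrictRep_fixedPoints r.ρ P₁ (U (τ.head d₁) ⊔ U (τ.tail d₁)) hPU₁
  obtain ⟨f₀, hfP₀, hf0₀⟩ : ∃ f₀ : Gqs L v → ℂ, (∀ (g : Gqs L v) (hg : g ∈ P₀), f₀ g = Representation.character τ₀ ⟨g, hg⟩⁻¹) ∧ ∀ g ∉ P₀, f₀ g = 0 :=
    ⟨fun g => if hg : g ∈ P₀ then Representation.character τ₀ ⟨g, hg⟩⁻¹ else 0, fun g hg => dif_pos hg, fun g hg => dif_neg hg⟩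
  obtain ⟨f₂, hfP₂, hf0₂⟩ : ∃ f₂ : Gqs L v → ℂ, (∀ (g : Gqs L v) (hg : g ∈ P₂), f₂ g = Representation.character τ₂ ⟨g, hg⟩⁻¹) ∧ ∀ g ∉ P₂, f₂ g = 0 :=
    ⟨fun g => if hg : g ∈ P₂ then Representation.character τ₂ ⟨g, hg⟩⁻¹ else 0, fun g hg => dif_pos hg, fun g hg => dif_neg hg⟩
  obtain ⟨f₁, hfP₁, hf0₁⟩ : ∃ f₁ : Gqs L v → ℂ, (∀ (g : Gqs L v) (hg : g ∈ P₁), f₁ g = Representation.character τ₁ ⟨g, hg⟩⁻¹) ∧ ∀ g ∉ P₁, f₁ g = 0 :=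
    ⟨fun g => if hg : g ∈ P₁ then Representation.character τ₁ ⟨g, hg⟩⁻¹ else 0, fun g hg => dif_pos hg, fun g hg => dif_neg hg⟩
  exact innerG_char_cross_eq_zero_of_ramificationIdx_ne_one_explicit_pieces_of_h61 L v hns w hw he hϖ eA heA νQv mQv hcanQ 𝔇 hμG horb hreg hE hM1 h61 hWIF hC1 hC2 hC3 hL2 ha τ hτ hU hUo hUc hEo hEc hA0 hA1 d₁ hd₁
    P₀ P₂ P₁ hP₀ hP₂ hP₁ r hex₀ τ₀ hτρ₀ hτ₀ τ₂ hτρ₂ hτ₂ τ₁ hτρ₁ hτ₁ hfP₀ hf0₀ hfP₂ hf0₂ hfP₁ hf0₁ r' hsplit₂ hHom0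



/-! ## §4-W (ED. 2, append-only) THE HEAD WITH `h61` DISCHARGED by ★ 61b-W — the exact wild twin of ★ NW-B-RAM §3 `innerG_char_cross_eq_zero_of_neg_explicit` -/

set_option maxHeartbeats 1600000 in
-- instance-term unification on the CM local carriers and the vertex subtype (as §3-W)
/-- **§4-W CROSS-NORM-ZERO AT EVERY RAMIFIED PLACE (tame or WILD), (G3)-EXPLICIT letters, NO residual binder** — §3-W `…_explicit_of_h61` with its row-61 binder `h61` DISCHARGED by ★ 61b-W
`K2E3EPInducedTraceZeroAtDatumDischargeWild.smoothTrace_cmPrincipalSeries_epFunction_eq_zero_of_ramificationIdx_ne_one L v νQv w hw he hϖ eA` (K2E3-p16): the statement of ★ NW-B-RAM §3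
`innerG_char_cross_eq_zero_of_neg_explicit` VERBATIM with the single binder substitution «`(hσ hvσ hϖ hσϖ hres h2 hnorm)` ↦ `(he) (hϖ)`» — for irreducible smooth `r, r′` of `U(Φ₃)(L⁺_v)` with every smooth
extension of `r` by `r′` split (`hsplit₂`) and `Hom_G(r, r′) = 0` (`hHom0`), `⟨χ_⟦r′⟧, χ_⟦r⟧⟩_e = 0`, at EVERY ramified `w ∣ v`.  W₂ `sig_K2E3InnerGCharCrossEqZeroWild`'s payer reads this head.
[cite: Rogawski1990, §12.6 p. 187; Prop. 12.6.1 (b) p. 188] [cite: SchneiderStuhler1997, Thm. III.4.16, §III.4] [cite: Kottwitz1988, §2] [cite: BruhatTits1972, §10] -/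
theorem innerG_char_cross_eq_zero_of_ramificationIdx_ne_one_explicit
    (hns : ∀ w : PlacesOver L v, IsCMField.complexConj L • w.1 = w.1)
    (w : PlacesOver L v) (hw : IsCMField.complexConj L • w.1 = w.1) {ϖ : w.1.adicCompletion L}
    (he : v.asIdeal.ramificationIdx' w.1.asIdeal ≠ 1) (hϖ : Valued.v ϖ = WithZero.exp (-1 : ℤ))
    (eA : Gqs L v ≃ₜ* ↥(unitaryGroupOfForm (galAdicCompletionMap (L := L) (IsCMField.complexConj L) hw) ((StdForm.antidiagonal 3).over (w.1.adicCompletion L))))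
    (heA : ∀ g : Gqs L v, ((eA g : ↥(unitaryGroupOfForm (galAdicCompletionMap (L := L) (IsCMField.complexConj L) hw) ((StdForm.antidiagonal 3).over (w.1.adicCompletion L)))) : GL (Fin 3) (w.1.adicCompletion L)) = ((localNonsplitEquiv (IsCMField.complexConj L) (qsForm L) (IsCMField.complexConj_ne_one L) w hw g : ↥(unitaryGroupOfForm (galAdicCompletionMap (L := L) (IsCMField.complexConj L) hw) (placeForm (qsForm L) w.1))) : GL (Fin 3) (w.1.adicCompletion L)))
    [MeasurableSpace (Gqs L v)] [BorelSpace (Gqs L v)]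
    [∀ γ : Gqs L v, MeasurableSpace (Gqs L v ⧸ Subgroup.centralizer ({γ} : Set (Gqs L v)))] [∀ γ : Gqs L v, BorelSpace (Gqs L v ⧸ Subgroup.centralizer ({γ} : Set (Gqs L v)))]
    [MeasurableSpace (Gqs L v ⧸ Subgroup.center (Gqs L v))]
    {H : Type} [Group H] [TopologicalSpace H] [IsTopologicalGroup H] [MeasurableSpace H]
    (νQv : Measure (Gqs L v)) [νQv.IsHaarMeasure] [νQv.IsMulRightInvariant] (mQv : OrbitalMeasureFamily (Gqs L v))
    (hcanQ : mQv.IsCanonical (fun γ => IsRegularElt (γ.val : GL (Fin 3) (UnitaryGroup.LocalRing L v))) νQv)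
    (𝔇 : EllipticData (Gqs L v) H) (hμG : 𝔇.μG = νQv) (horb : 𝔇.orb = mQv)
    (hreg : ∀ γ : Gqs L v, γ ∈ 𝔇.regG ↔ IsRegularElt (γ.val : GL (Fin 3) (UnitaryGroup.LocalRing L v)))
    (hE : ∀ γ : Gqs L v, γ ∈ 𝔇.ellG ↔ IsRegularElt (γ.val : GL (Fin 3) (UnitaryGroup.LocalRing L v)) ∧ γ ∉ hyperbolicSet L v)
    (hM1 : ∀ π : IrrClass (Gqs L v), Measurable (𝔇.char π) ∧ LocallyIntegrable (𝔇.char π) 𝔇.μG ∧ (∀ x ∈ 𝔇.regG, ∀ᶠ y in 𝓝 x, 𝔇.char π y = 𝔇.char π x) ∧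
      ∀ φ : Gqs L v → ℂ, IsLocSmooth φ → π.smoothTrace 𝔇.μG φ = ∫ x, φ x * 𝔇.char π x ∂𝔇.μG)
    (hWIF : 𝔇.WeylIntegrationFormula) (hC1 : 𝔇.EllCartanSubset) (hC2 : 𝔇.EllCartanAE) (hC3 : 𝔇.NonEllCartanAE) (hL2 : 𝔇.L2CharOnTorusAll)   -- ★ PCT-OUT's extra letters
    (r : SmoothIrrep (Gqs L v))
    -- the CROSS letters: a second irreducible smooth `r′`; every SMOOTH extension of `r.ρ` BY `r′.ρ` splits (★ (J′)'s text at `V := r.ρ`, `W := r′.ρ`); `Hom_G(r, r′) = 0`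
    (r' : SmoothIrrep (Gqs L v))
    (hsplit₂ : ∀ (E : Type) [AddCommGroup E] [Module ℂ E] (ρE : Representation ℂ (Gqs L v) E), ρE.IsSmooth →
      ∀ (i : r'.ρ.IntertwiningMap ρE) (p : ρE.IntertwiningMap r.ρ), Function.Injective i → LinearMap.ker p.toLinearMap = LinearMap.range i.toLinearMap →
        Function.Surjective p → ∃ s : r.ρ.IntertwiningMap ρE, p.comp s = Representation.IntertwiningMap.id r.ρ)
    (hHom0 : Subsingleton (r.ρ.IntertwiningMap r'.ρ)) :
    𝔇.innerG (𝔇.char (IrrClass.mk r')) (𝔇.char (IrrClass.mk r)) = 0 :=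
  innerG_char_cross_eq_zero_of_ramificationIdx_ne_one_explicit_of_h61 L v hns w hw he hϖ eA heA νQv mQv hcanQ 𝔇 hμG horb hreg hE hM1
    (K2E3EPInducedTraceZeroAtDatumDischargeWild.smoothTrace_cmPrincipalSeries_epFunction_eq_zero_of_ramificationIdx_ne_one L v νQv w hw he hϖ eA)
    hWIF hC1 hC2 hC3 hL2 r r' hsplit₂ hHom0

end Head

end Summit.HodgeConjecture.HodgeConjecture.Cruxes.H413.K2E3EPCrossNormZeroExplicitWild

end
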